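import Summits.QuantumAdvantage.AdviceFreeQNC0.WindowCharacters
import HarnessLib

/-!
# Cell qa-qnc0 (rung F-Q1, route RingFrame, crux α): walk characters of a strategy supported on the
# two ends and TWO interior windows — local data plus three unknown block residues

Bookkeeping for the two-interior-window special case of the crux α (`RingHardU`, file
`TwoWindowStrategies.lean`), extending `WindowCharacters.lean`.  Fix split points `P₁ ≤ P₂` (the
window anchors) and a width `K`; write `X = |u_{<P₁}|`, `Y = |u_{[P₁,P₂)}|`, `Z = |u_{≥P₂}|`.  The
walk character of position `g` is, modulo `3`, local data plus `X + Y + Z` (LEFT, `g < K`),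
`2X + Y + Z` (first window `[P₁, P₁+K)`), `2X + 2Y + Z` (second window `[P₂, P₂+K)`),
`2X + 2Y + 2Z` (RIGHT) — `windowChar3_iff`; so the win bit is `N(u; X, Y, Z) mod 2`
(`ringWinU_eq_windowCount3`), the 27 hypothetical counts sum to `18·#selected`
(`sum_windowCounts3`), some residue triple has an even count (`exists_windowCount3_even`), and
each parity bit has degree `≤ D + K` (`hasDeg_windowParity3`).

The cell's statements (prover); not in print.  WHAT THIS IS NOT: the decoder and the appeal to
`tripleElimHard` are in `TwoWindowStrategies.lean`; nothing on ≥ 3 interior windows, on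
`LDMAPolylog`, `TRPlus` or α in general; no separation.
-/

noncomputable section

namespace Summit.QuantumAdvantage.AdviceFreeQNC0

open Finset
open Literature.Computability.MetaComplexity Literature.Computability.MetaComplexity.Smolensky

variable {n : ℕ}

/-! ### The local form of the characters with three unknown block residues -/

/-- **Two-window form of the character at position `g`** (split points `P₁ ≤ P₂`, width `K`):
modulo `3` the character `c + g + |u| + W_g(u)` equals `A_g(u) + α_g X + β_g Y + γ_g Z` with
`X = W_{P₁}(u)`, `Y = W_{P₂}(u) − W_{P₁}(u)`, `Z = |u| − W_{P₂}(u)`. (Cell bookkeeping.) -/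
theorem windowChar3_iff (c K P₁ P₂ : ℕ) (hP : P₁ ≤ P₂) (u : Fin n → Bool) (g : Fin (n + 1))
    (X' Y' Z' : ℕ) (hX : X' = wtPrefix u P₁) (hY : Y' = wtPrefix u P₂ - wtPrefix u P₁)
    (hZ : Z' = wt u - wtPrefix u P₂) :
    (c + g.val + walkExp u g.val) % 3 ≠ 0 ↔
      ((if g.val < K then c + g.val + wtPrefix u g.val
        else if P₁ ≤ g.val ∧ g.val < P₁ + K then
          c + g.val + (univ.filter fun i : Fin n => P₁ ≤ i.val ∧ i.val < g.val ∧ u i = true).card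
        else if P₂ ≤ g.val ∧ g.val < P₂ + K then
          c + g.val + (univ.filter fun i : Fin n => P₂ ≤ i.val ∧ i.val < g.val ∧ u i = true).card
        else c + g.val + 2 * (univ.filter fun i : Fin n => g.val ≤ i.val ∧ u i = true).card) +
        (if g.val < K then 1 else 2) * X' +
        (if g.val < K then 1 else if P₁ ≤ g.val ∧ g.val < P₁ + K then 1 else 2) * Y' +
        (if g.val < K then 1 else if P₁ ≤ g.val ∧ g.val < P₁ + K then 1 else if P₂ ≤ g.val ∧ g.val < P₂ + K then 1 else 2) * Z') % 3 ≠ 0 := by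
  unfold walkExp
  have hsum1 := wtPrefix_add_wtSuffix u P₁
  have hsum2 := wtPrefix_add_wtSuffix u P₂
  have hsumg := wtPrefix_add_wtSuffix u g.val
  have h12 := wtPrefix_eq_add_midCount u hP
  subst hX; subst hY; subst hZ
  by_cases hK : g.val < K
  · simp only [if_pos hK]
    constructor <;> intro h <;> omega
  · simp only [if_neg hK]
    by_cases hM1 : P₁ ≤ g.val ∧ g.val < P₁ + K
    · simp only [if_pos hM1]
      have hmid := wtPrefix_eq_add_midCount u hM1.1
      constructor <;> intro h <;> omega
    · simp only [if_neg hM1]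
      by_cases hM2 : P₂ ≤ g.val ∧ g.val < P₂ + K
      · simp only [if_pos hM2]
        have hmid := wtPrefix_eq_add_midCount u hM2.1
        constructor <;> intro h <;> omega
      · simp only [if_neg hM2]
        constructor <;> intro h <;> omega

/-- The count `N(u; X', Y', Z')` depends on the residues only. (Cell bookkeeping.) -/
theorem windowCount3_mod (c K P₁ P₂ : ℕ) (y : Fin (n + 1) → (Fin n → Bool) → Bool)
    (u : Fin n → Bool) (X' Y' Z' : ℕ) :
    (univ.filter fun g : Fin (n + 1) => y g u = true ∧
      ((if g.val < K then c + g.val + wtPrefix u g.val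
        else if P₁ ≤ g.val ∧ g.val < P₁ + K then
          c + g.val + (univ.filter fun i : Fin n => P₁ ≤ i.val ∧ i.val < g.val ∧ u i = true).card
        else if P₂ ≤ g.val ∧ g.val < P₂ + K then
          c + g.val + (univ.filter fun i : Fin n => P₂ ≤ i.val ∧ i.val < g.val ∧ u i = true).card
        else c + g.val + 2 * (univ.filter fun i : Fin n => g.val ≤ i.val ∧ u i = true).card) +
        (if g.val < K then 1 else 2) * X' +
        (if g.val < K then 1 else if P₁ ≤ g.val ∧ g.val < P₁ + K then 1 else 2) * Y' +
        (if g.val < K then 1 else if P₁ ≤ g.val ∧ g.val < P₁ + K then 1 else if P₂ ≤ g.val ∧ g.val < P₂ + K then 1 else 2) * Z') % 3 ≠ 0).card =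
    (univ.filter fun g : Fin (n + 1) => y g u = true ∧
      ((if g.val < K then c + g.val + wtPrefix u g.val
        else if P₁ ≤ g.val ∧ g.val < P₁ + K then
          c + g.val + (univ.filter fun i : Fin n => P₁ ≤ i.val ∧ i.val < g.val ∧ u i = true).card
        else if P₂ ≤ g.val ∧ g.val < P₂ + K then
          c + g.val + (univ.filter fun i : Fin n => P₂ ≤ i.val ∧ i.val < g.val ∧ u i = true).card
        else c + g.val + 2 * (univ.filter fun i : Fin n => g.val ≤ i.val ∧ u i = true).card) +
        (if g.val < K then 1 else 2) * (X' % 3) +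
        (if g.val < K then 1 else if P₁ ≤ g.val ∧ g.val < P₁ + K then 1 else 2) * (Y' % 3) +
        (if g.val < K then 1 else if P₁ ≤ g.val ∧ g.val < P₁ + K then 1 else if P₂ ≤ g.val ∧ g.val < P₂ + K then 1 else 2) * (Z' % 3)) % 3 ≠ 0).card := by
  refine congrArg _ (Finset.filter_congr fun g _ => ?_)
  by_cases hK : g.val < K
  · simp only [if_pos hK]; constructor <;> rintro ⟨h1, h2⟩ <;> exact ⟨h1, by omega⟩
  · simp only [if_neg hK]
    by_cases hM1 : P₁ ≤ g.val ∧ g.val < P₁ + K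
    · simp only [if_pos hM1]; constructor <;> rintro ⟨h1, h2⟩ <;> exact ⟨h1, by omega⟩
    · simp only [if_neg hM1]
      by_cases hM2 : P₂ ≤ g.val ∧ g.val < P₂ + K
      · simp only [if_pos hM2]; constructor <;> rintro ⟨h1, h2⟩ <;> exact ⟨h1, by omega⟩
      · simp only [if_neg hM2]; constructor <;> rintro ⟨h1, h2⟩ <;> exact ⟨h1, by omega⟩

/-- **The win bit is `N(u; X, Y, Z) mod 2`** with the true block weights. (Cell bookkeeping.) -/
theorem ringWinU_eq_windowCount3 (c K P₁ P₂ : ℕ) (hP : P₁ ≤ P₂)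
    (y : Fin (n + 1) → (Fin n → Bool) → Bool) (u : Fin n → Bool) :
    ringWinU c y u = decide ((univ.filter fun g : Fin (n + 1) => y g u = true ∧
      ((if g.val < K then c + g.val + wtPrefix u g.val
        else if P₁ ≤ g.val ∧ g.val < P₁ + K then
          c + g.val + (univ.filter fun i : Fin n => P₁ ≤ i.val ∧ i.val < g.val ∧ u i = true).card
        else if P₂ ≤ g.val ∧ g.val < P₂ + K then
          c + g.val + (univ.filter fun i : Fin n => P₂ ≤ i.val ∧ i.val < g.val ∧ u i = true).card
        else c + g.val + 2 * (univ.filter fun i : Fin n => g.val ≤ i.val ∧ u i = true).card) +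
        (if g.val < K then 1 else 2) * wtPrefix u P₁ +
        (if g.val < K then 1 else if P₁ ≤ g.val ∧ g.val < P₁ + K then 1 else 2) * (wtPrefix u P₂ - wtPrefix u P₁) +
        (if g.val < K then 1 else if P₁ ≤ g.val ∧ g.val < P₁ + K then 1 else if P₂ ≤ g.val ∧ g.val < P₂ + K then 1 else 2) * (wt u - wtPrefix u P₂)) % 3 ≠ 0).card % 2 = 1) := by
  have h : (univ.filter fun g : Fin (n + 1) =>
      y g u = true ∧ (c + g.val + walkExp u g.val) % 3 ≠ 0) =
      univ.filter fun g : Fin (n + 1) => y g u = true ∧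
      ((if g.val < K then c + g.val + wtPrefix u g.val
        else if P₁ ≤ g.val ∧ g.val < P₁ + K then
          c + g.val + (univ.filter fun i : Fin n => P₁ ≤ i.val ∧ i.val < g.val ∧ u i = true).card
        else if P₂ ≤ g.val ∧ g.val < P₂ + K then
          c + g.val + (univ.filter fun i : Fin n => P₂ ≤ i.val ∧ i.val < g.val ∧ u i = true).card
        else c + g.val + 2 * (univ.filter fun i : Fin n => g.val ≤ i.val ∧ u i = true).card) +
        (if g.val < K then 1 else 2) * wtPrefix u P₁ +
        (if g.val < K then 1 else if P₁ ≤ g.val ∧ g.val < P₁ + K then 1 else 2) * (wtPrefix u P₂ - wtPrefix u P₁) +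
        (if g.val < K then 1 else if P₁ ≤ g.val ∧ g.val < P₁ + K then 1 else if P₂ ≤ g.val ∧ g.val < P₂ + K then 1 else 2) * (wt u - wtPrefix u P₂)) % 3 ≠ 0 := by
    refine Finset.filter_congr fun g _ => ?_
    rw [windowChar3_iff c K P₁ P₂ hP u g _ _ _ rfl rfl rfl]
  unfold ringWinU
  rw [h]

/-! ### The parity obstruction over the 27 residue triples -/

/-- **Parity obstruction, three unknowns.** The 27 counts sum to `18·#selected`.
(Cell statement.) -/
theorem sum_windowCounts3 {ι : Type*} (s : Finset ι) (A α β γ : ι → ℕ)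
    (hγ : ∀ g ∈ s, γ g % 3 ≠ 0) :
    (∑ X' ∈ range 3, ∑ Y' ∈ range 3, ∑ Z' ∈ range 3,
      (s.filter fun g => (A g + α g * X' + β g * Y' + γ g * Z') % 3 ≠ 0).card) = 18 * s.card := by
  classical
  have hin : ∀ X' ∈ range 3, (∑ Y' ∈ range 3, ∑ Z' ∈ range 3,
      (s.filter fun g => (A g + α g * X' + β g * Y' + γ g * Z') % 3 ≠ 0).card) = 6 * s.card := by
    intro X' _
    exact sum_windowCounts s (fun g => A g + α g * X') β γ hγ
  rw [Finset.sum_congr rfl hin, Finset.sum_const, Finset.card_range, smul_eq_mul]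
  ring

/-- Hence some residue triple has an even count. [folklore] -/
theorem exists_windowCount3_even {ι : Type*} (s : Finset ι) (A α β γ : ι → ℕ)
    (hγ : ∀ g ∈ s, γ g % 3 ≠ 0) :
    ∃ X₀ Y₀ Z₀, X₀ < 3 ∧ Y₀ < 3 ∧ Z₀ < 3 ∧
      (s.filter fun g => (A g + α g * X₀ + β g * Y₀ + γ g * Z₀) % 3 ≠ 0).card % 2 = 0 := by
  by_contra hno
  push Not at hno
  have hs := sum_windowCounts3 s A α β γ hγ
  have hodd : ∀ X' ∈ range 3, ∀ Y' ∈ range 3, ∀ Z' ∈ range 3,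
      (s.filter fun g => (A g + α g * X' + β g * Y' + γ g * Z') % 3 ≠ 0).card % 2 = 1 := by
    intro X' hX Y' hY Z' hZ
    have := hno X' Y' Z' (Finset.mem_range.1 hX) (Finset.mem_range.1 hY) (Finset.mem_range.1 hZ)
    omega
  have h27 : (∑ X' ∈ range 3, ∑ Y' ∈ range 3, ∑ Z' ∈ range 3,
      (s.filter fun g => (A g + α g * X' + β g * Y' + γ g * Z') % 3 ≠ 0).card) % 2 = 1 := by
    rw [Finset.sum_nat_mod]
    have hin : ∀ X' ∈ range 3, (∑ Y' ∈ range 3, ∑ Z' ∈ range 3,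
        (s.filter fun g => (A g + α g * X' + β g * Y' + γ g * Z') % 3 ≠ 0).card) % 2 = 1 := by
      intro X' hX
      rw [Finset.sum_nat_mod]
      have hin2 : ∀ Y' ∈ range 3, (∑ Z' ∈ range 3,
          (s.filter fun g => (A g + α g * X' + β g * Y' + γ g * Z') % 3 ≠ 0).card) % 2 = 1 := by
        intro Y' hY
        rw [Finset.sum_nat_mod, Finset.sum_congr rfl (fun Z' hZ => hodd X' hX Y' hY Z' hZ)]
        simp
      rw [Finset.sum_congr rfl hin2]
      simp
    rw [Finset.sum_congr rfl hin]
    simp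
  rw [hs] at h27
  omega

/-! ### Degree of the parity bits -/

/-- **Each parity bit `[N(u; X', Y', Z') odd]` has degree `≤ D + K`** for a strategy of degree
`≤ D` supported on `{g < K} ∪ [P₁, P₁+K) ∪ [P₂, P₂+K) ∪ {g > n − K}`. (Cell statement.) -/
theorem hasDeg_windowParity3 {D : ℕ} (c K P₁ P₂ : ℕ) (y : Fin (n + 1) → (Fin n → Bool) → Bool)
    (hdeg : ∀ g, HasDeg (y g) D)
    (hsupp : ∀ g : Fin (n + 1), K ≤ g.val → (g.val < P₁ ∨ P₁ + K ≤ g.val) →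
      (g.val < P₂ ∨ P₂ + K ≤ g.val) → g.val + K ≤ n → ∀ u, y g u = false)
    (X' Y' Z' : ℕ) :
    HasDeg (fun u : Fin n → Bool => decide ((univ.filter fun g : Fin (n + 1) =>
      (y g u && decide (((if g.val < K then c + g.val + wtPrefix u g.val
        else if P₁ ≤ g.val ∧ g.val < P₁ + K then
          c + g.val + (univ.filter fun i : Fin n => P₁ ≤ i.val ∧ i.val < g.val ∧ u i = true).card
        else if P₂ ≤ g.val ∧ g.val < P₂ + K then
          c + g.val + (univ.filter fun i : Fin n => P₂ ≤ i.val ∧ i.val < g.val ∧ u i = true).card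
        else c + g.val + 2 * (univ.filter fun i : Fin n => g.val ≤ i.val ∧ u i = true).card) +
        (if g.val < K then 1 else 2) * X' +
        (if g.val < K then 1 else if P₁ ≤ g.val ∧ g.val < P₁ + K then 1 else 2) * Y' +
        (if g.val < K then 1 else if P₁ ≤ g.val ∧ g.val < P₁ + K then 1 else if P₂ ≤ g.val ∧ g.val < P₂ + K then 1 else 2) * Z') % 3 ≠ 0)) = true).card % 2 = 1)) (D + K) := by
  classical
  refine hasDeg_parity _ _ fun g _ => ?_
  by_cases hgK : g.val < K
  · -- LEFT
    have hgn : g.val ≤ n := by omega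
    have h := hasDeg_comp_window (n := n) (Fin.castLE hgn)
      (fun v : Fin g.val → Bool => decide ((c + g.val +
        (univ.filter fun j : Fin g.val => v j = true).card + 1 * X' + 1 * Y' + 1 * Z') % 3 ≠ 0))
    have heq : (fun u : Fin n → Bool => decide (((if g.val < K then c + g.val + wtPrefix u g.val
        else if P₁ ≤ g.val ∧ g.val < P₁ + K then
          c + g.val + (univ.filter fun i : Fin n => P₁ ≤ i.val ∧ i.val < g.val ∧ u i = true).card
        else if P₂ ≤ g.val ∧ g.val < P₂ + K then
          c + g.val + (univ.filter fun i : Fin n => P₂ ≤ i.val ∧ i.val < g.val ∧ u i = true).card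
        else c + g.val + 2 * (univ.filter fun i : Fin n => g.val ≤ i.val ∧ u i = true).card) +
        (if g.val < K then 1 else 2) * X' +
        (if g.val < K then 1 else if P₁ ≤ g.val ∧ g.val < P₁ + K then 1 else 2) * Y' +
        (if g.val < K then 1 else if P₁ ≤ g.val ∧ g.val < P₁ + K then 1 else if P₂ ≤ g.val ∧ g.val < P₂ + K then 1 else 2) * Z') % 3 ≠ 0)) =
        fun u : Fin n → Bool => (fun v : Fin g.val → Bool => decide ((c + g.val +
          (univ.filter fun j : Fin g.val => v j = true).card + 1 * X' + 1 * Y' + 1 * Z') % 3 ≠ 0))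
          (fun j => u (Fin.castLE hgn j)) := by
      funext u
      simp only [if_pos hgK, wtPrefix_eq_card_window u hgn]
    rw [← heq] at h
    exact hasDeg_and (hdeg g) (hasDeg_of_le h (by omega))
  · by_cases hM1 : P₁ ≤ g.val ∧ g.val < P₁ + K
    · -- first window
      have hgn : g.val ≤ n := by omega
      have h := hasDeg_comp_window (n := n)
        (fun j : Fin (g.val - P₁) => (⟨P₁ + j.val, by omega⟩ : Fin n))
        (fun v : Fin (g.val - P₁) → Bool => decide ((c + g.val +
          (univ.filter fun j : Fin (g.val - P₁) => v j = true).card + 2 * X' + 1 * Y' + 1 * Z') % 3 ≠ 0))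
      have heq : (fun u : Fin n → Bool => decide (((if g.val < K then c + g.val + wtPrefix u g.val
        else if P₁ ≤ g.val ∧ g.val < P₁ + K then
          c + g.val + (univ.filter fun i : Fin n => P₁ ≤ i.val ∧ i.val < g.val ∧ u i = true).card
        else if P₂ ≤ g.val ∧ g.val < P₂ + K then
          c + g.val + (univ.filter fun i : Fin n => P₂ ≤ i.val ∧ i.val < g.val ∧ u i = true).card
        else c + g.val + 2 * (univ.filter fun i : Fin n => g.val ≤ i.val ∧ u i = true).card) +
        (if g.val < K then 1 else 2) * X' +
        (if g.val < K then 1 else if P₁ ≤ g.val ∧ g.val < P₁ + K then 1 else 2) * Y' +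
        (if g.val < K then 1 else if P₁ ≤ g.val ∧ g.val < P₁ + K then 1 else if P₂ ≤ g.val ∧ g.val < P₂ + K then 1 else 2) * Z') % 3 ≠ 0)) =
          fun u : Fin n → Bool => (fun v : Fin (g.val - P₁) → Bool => decide ((c + g.val +
            (univ.filter fun j : Fin (g.val - P₁) => v j = true).card + 2 * X' + 1 * Y' + 1 * Z') % 3 ≠ 0))
            (fun j => u ⟨P₁ + j.val, by omega⟩) := by
        funext u
        simp only [if_neg hgK, if_pos hM1, midCount_eq_card_window u hgn]
      rw [← heq] at h
      exact hasDeg_and (hdeg g) (hasDeg_of_le h (by omega))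
    · by_cases hM2 : P₂ ≤ g.val ∧ g.val < P₂ + K
      · -- second window
        have hgn : g.val ≤ n := by omega
        have h := hasDeg_comp_window (n := n)
          (fun j : Fin (g.val - P₂) => (⟨P₂ + j.val, by omega⟩ : Fin n))
          (fun v : Fin (g.val - P₂) → Bool => decide ((c + g.val +
            (univ.filter fun j : Fin (g.val - P₂) => v j = true).card + 2 * X' + 2 * Y' + 1 * Z') % 3 ≠ 0))
        have heq : (fun u : Fin n → Bool => decide (((if g.val < K then c + g.val + wtPrefix u g.val
        else if P₁ ≤ g.val ∧ g.val < P₁ + K then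
          c + g.val + (univ.filter fun i : Fin n => P₁ ≤ i.val ∧ i.val < g.val ∧ u i = true).card
        else if P₂ ≤ g.val ∧ g.val < P₂ + K then
          c + g.val + (univ.filter fun i : Fin n => P₂ ≤ i.val ∧ i.val < g.val ∧ u i = true).card
        else c + g.val + 2 * (univ.filter fun i : Fin n => g.val ≤ i.val ∧ u i = true).card) +
        (if g.val < K then 1 else 2) * X' +
        (if g.val < K then 1 else if P₁ ≤ g.val ∧ g.val < P₁ + K then 1 else 2) * Y' +
        (if g.val < K then 1 else if P₁ ≤ g.val ∧ g.val < P₁ + K then 1 else if P₂ ≤ g.val ∧ g.val < P₂ + K then 1 else 2) * Z') % 3 ≠ 0)) =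
            fun u : Fin n → Bool => (fun v : Fin (g.val - P₂) → Bool => decide ((c + g.val +
              (univ.filter fun j : Fin (g.val - P₂) => v j = true).card + 2 * X' + 2 * Y' + 1 * Z') % 3 ≠ 0))
              (fun j => u ⟨P₂ + j.val, by omega⟩) := by
          funext u
          simp only [if_neg hgK, if_neg hM1, if_pos hM2, midCount_eq_card_window u hgn]
        rw [← heq] at h
        exact hasDeg_and (hdeg g) (hasDeg_of_le h (by omega))
      · by_cases hgR : n < g.val + K
        · -- RIGHT
          have hgn : g.val ≤ n := by omega
          have h := hasDeg_comp_window (n := n)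
            (fun j : Fin (n - g.val) => (⟨g.val + j.val, by omega⟩ : Fin n))
            (fun v : Fin (n - g.val) → Bool => decide ((c + g.val +
              2 * (univ.filter fun j : Fin (n - g.val) => v j = true).card + 2 * X' + 2 * Y' + 2 * Z') % 3 ≠ 0))
          have heq : (fun u : Fin n → Bool => decide (((if g.val < K then c + g.val + wtPrefix u g.val
        else if P₁ ≤ g.val ∧ g.val < P₁ + K then
          c + g.val + (univ.filter fun i : Fin n => P₁ ≤ i.val ∧ i.val < g.val ∧ u i = true).card
        else if P₂ ≤ g.val ∧ g.val < P₂ + K then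
          c + g.val + (univ.filter fun i : Fin n => P₂ ≤ i.val ∧ i.val < g.val ∧ u i = true).card
        else c + g.val + 2 * (univ.filter fun i : Fin n => g.val ≤ i.val ∧ u i = true).card) +
        (if g.val < K then 1 else 2) * X' +
        (if g.val < K then 1 else if P₁ ≤ g.val ∧ g.val < P₁ + K then 1 else 2) * Y' +
        (if g.val < K then 1 else if P₁ ≤ g.val ∧ g.val < P₁ + K then 1 else if P₂ ≤ g.val ∧ g.val < P₂ + K then 1 else 2) * Z') % 3 ≠ 0)) =
              fun u : Fin n → Bool => (fun v : Fin (n - g.val) → Bool => decide ((c + g.val +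
                2 * (univ.filter fun j : Fin (n - g.val) => v j = true).card + 2 * X' + 2 * Y' + 2 * Z') % 3 ≠ 0))
                (fun j => u ⟨g.val + j.val, by omega⟩) := by
            funext u
            simp only [if_neg hgK, if_neg hM1, if_neg hM2, wtSuffix_eq_card_window u hgn]
          rw [← heq] at h
          exact hasDeg_and (hdeg g) (hasDeg_of_le h (by omega))
        · -- interior: the selector vanishes
          push Not at hgK hgR
          have hout1 : g.val < P₁ ∨ P₁ + K ≤ g.val := by
            by_contra hno; push Not at hno; exact hM1 ⟨hno.1, hno.2⟩
          have hout2 : g.val < P₂ ∨ P₂ + K ≤ g.val := by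
            by_contra hno; push Not at hno; exact hM2 ⟨hno.1, hno.2⟩
          have hzero : (fun u : Fin n → Bool => y g u && decide (((if g.val < K then c + g.val + wtPrefix u g.val
        else if P₁ ≤ g.val ∧ g.val < P₁ + K then
          c + g.val + (univ.filter fun i : Fin n => P₁ ≤ i.val ∧ i.val < g.val ∧ u i = true).card
        else if P₂ ≤ g.val ∧ g.val < P₂ + K then
          c + g.val + (univ.filter fun i : Fin n => P₂ ≤ i.val ∧ i.val < g.val ∧ u i = true).card
        else c + g.val + 2 * (univ.filter fun i : Fin n => g.val ≤ i.val ∧ u i = true).card) +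
        (if g.val < K then 1 else 2) * X' +
        (if g.val < K then 1 else if P₁ ≤ g.val ∧ g.val < P₁ + K then 1 else 2) * Y' +
        (if g.val < K then 1 else if P₁ ≤ g.val ∧ g.val < P₁ + K then 1 else if P₂ ≤ g.val ∧ g.val < P₂ + K then 1 else 2) * Z') % 3 ≠ 0)) =
              fun _ => false := by
            funext u; rw [hsupp g hgK hout1 hout2 hgR u, Bool.false_and]
          rw [hzero]
          exact hasDeg_false _

end Summit.QuantumAdvantage.AdviceFreeQNC0
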